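import Mathlib
import Literature.Probability.LatticeModels.DomainDiscretisation
import Literature.Probability.LatticeModels.LatticeGraph
import Literature.Probability.LatticeModels.WeakBeurlingEstimate
import HarnessLib

/-!
# The lattice window at a flat boundary point

Topic `Literature/Probability/LatticeModels` (planar topology + the mesh lattice `δℤ²` of
`DomainDiscretisation.lean`). Third instalment of the inline proof programme for the tree facts
`ChelkakSmirnov2011_boundaryNormalisedPoissonKernelLimit` and `Kenyon2000_flatEdgePoissonKernelLimit`
(`FlatBoundaryPoissonKernelLimit.lean`), whose hypotheses describe a boundary point `y` of an open
set `D ⊆ ℂ` near which the frontier is a horizontal (or vertical) segment, the lattice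
approximation `V = {v : meshPoint δ v ∈ D̄}` and a lattice point `b ∈ V` with exactly one lattice
neighbour outside `V` close to `y`. This file turns those hypotheses into the local half-plane
structure consumed by the lattice estimates of `BoundaryPoleGreenBounds.lean` (the "window"
hypothesis `z ∈ V ↔ z₁ ≥ b₁` for `|z₀ - b₀|, |z₁ - b₁| ≤ W`):

* `upperHalfBall_subset_or_disjoint`, `lowerHalfBall_subset_or_disjoint` — if the frontier of the
  open set `D` meets the ball `B(y, r)` only on the horizontal line through `y`, each open half-ball
  is either inside `D` or disjoint from `D̄` (a convex set missing the frontier);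
* `upperHalfBall_subset_or_lowerHalfBall_subset` — for `y ∈ ∂D` at least one half-ball lies in `D`;
* `mem_closure_of_im_eq` — the diameter lies in `D̄` as soon as one half-ball lies in `D`;
* `mem_closure_iff_im_ge` / `mem_closure_iff_im_le` — one-sided structure: if the upper half-ball
  lies in `D` and the lower one misses `D̄`, then `D̄ ∩ B(y, r) = {Im ≥ Im y} ∩ B(y, r)` (and the
  mirror statement);
* `card_filter_not_mem_eq_zero_of_twoSided` — if BOTH half-balls lie in `D`, every lattice point
  whose mesh point is `δ`-inside the ball has all four neighbours in `V`: so the hypothesis "exactly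
  one neighbour outside `V`" of the facts FORCES one-sidedness (`not_twoSided_of_card_eq_one`);
* `window_of_oneSided_ge` — **the lattice window**: in the one-sided situation `D̄ ∩ B = {Im ≥ Im y}`,
  a point `b ∈ V` with exactly one neighbour outside `V` and `dist(δ b, y) + 2δ(W + 1) < r` sits on
  the lowest lattice row of `D̄` and `z ∈ V ↔ z₁ ≥ b₁` throughout the window of half-width `W`
  (`window_of_oneSided_le` for the mirror case, with `z₁ ≤ b₁`).

Everything is proved, [folklore] planar topology. The vertical cases (frontier on a vertical line;
`rightHalfBall`/`leftHalfBall`, `mem_closure_iff_re_ge/_le`, `windowV_of_oneSided_ge/_le` with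
`z ∈ V ↔ z₀ ≥ b₀`, resp. `≤`) are written out in parallel.
-/

noncomputable section

namespace Literature.Probability.LatticeModels

open Set Metric _root_.Topology _root_.Filter

/-! ### Half-balls at a flat piece of the frontier -/

section Continuum

variable {D : Set ℂ} {y : ℂ} {r : ℝ}

/-- The open upper half-ball at `y`. [folklore] -/
def upperHalfBall (y : ℂ) (r : ℝ) : Set ℂ := ball y r ∩ {z : ℂ | y.im < z.im}

/-- The open lower half-ball at `y`. [folklore] -/
def lowerHalfBall (y : ℂ) (r : ℝ) : Set ℂ := ball y r ∩ {z : ℂ | z.im < y.im}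

/-- The upper half-ball is convex. [folklore] -/
theorem convex_upperHalfBall (y : ℂ) (r : ℝ) : Convex ℝ (upperHalfBall y r) :=
  (convex_ball y r).inter (convex_halfSpace_im_gt y.im)

/-- The lower half-ball is convex. [folklore] -/
theorem convex_lowerHalfBall (y : ℂ) (r : ℝ) : Convex ℝ (lowerHalfBall y r) :=
  (convex_ball y r).inter (convex_halfSpace_im_lt y.im)

/-- A preconnected set inside the ball that misses the horizontal line through `y` lies in `D` or
misses `D̄`, if the frontier of the open set `D` meets the ball only on that line. [folklore] -/
theorem subset_or_disjoint_of_flat (hD : IsOpen D)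
    (hflat : ∀ z ∈ frontier D, dist z y < r → z.im = y.im) {U : Set ℂ} (hU : IsPreconnected U)
    (hUball : U ⊆ ball y r) (hUline : ∀ z ∈ U, z.im ≠ y.im) :
    U ⊆ D ∨ Disjoint U (closure D) := by
  have hsub : U ⊆ D ∪ (closure D)ᶜ := by
    intro z hz
    by_cases hzc : z ∈ closure D
    · left
      by_contra hzD
      have hzf : z ∈ frontier D := by rw [hD.frontier_eq]; exact ⟨hzc, hzD⟩
      exact hUline z hz (hflat z hzf (mem_ball.1 (hUball hz)))
    · exact Or.inr hzc
  rcases hU.subset_or_subset hD isClosed_closure.isOpen_compl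
    (disjoint_compl_right.mono_left subset_closure) hsub with h | h
  · exact Or.inl h
  · exact Or.inr (Set.subset_compl_iff_disjoint_right.1 h)

/-- The upper half-ball lies in `D` or misses `D̄`. [folklore] -/
theorem upperHalfBall_subset_or_disjoint (hD : IsOpen D)
    (hflat : ∀ z ∈ frontier D, dist z y < r → z.im = y.im) :
    upperHalfBall y r ⊆ D ∨ Disjoint (upperHalfBall y r) (closure D) :=
  subset_or_disjoint_of_flat hD hflat (convex_upperHalfBall y r).isPreconnected inter_subset_left
    fun _ hz => ne_of_gt hz.2

/-- The lower half-ball lies in `D` or misses `D̄`. [folklore] -/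
theorem lowerHalfBall_subset_or_disjoint (hD : IsOpen D)
    (hflat : ∀ z ∈ frontier D, dist z y < r → z.im = y.im) :
    lowerHalfBall y r ⊆ D ∨ Disjoint (lowerHalfBall y r) (closure D) :=
  subset_or_disjoint_of_flat hD hflat (convex_lowerHalfBall y r).isPreconnected inter_subset_left
    fun _ hz => ne_of_lt hz.2

/-- Shifting a point of the ball slightly upwards keeps it in the ball. [folklore] -/
theorem exists_add_I_mem_ball {z : ℂ} (hz : z ∈ ball y r) {ε : ℝ} (hε : 0 < ε) :
    ∃ η : ℝ, 0 < η ∧ η < ε ∧ z + η * Complex.I ∈ ball y r ∧ z - η * Complex.I ∈ ball y r := by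
  have hslack : 0 < r - dist z y := by linarith [mem_ball.1 hz]
  refine ⟨min ε (r - dist z y) / 2, by positivity, by
    have := min_le_left ε (r - dist z y); linarith, ?_, ?_⟩
  · rw [mem_ball]
    calc dist (z + ↑(min ε (r - dist z y) / 2) * Complex.I) y
        ≤ dist (z + ↑(min ε (r - dist z y) / 2) * Complex.I) z + dist z y := dist_triangle _ _ _
      _ = |min ε (r - dist z y) / 2| + dist z y := by
          rw [dist_eq_norm, add_sub_cancel_left, norm_mul, Complex.norm_real, Complex.norm_I, mul_one,
            Real.norm_eq_abs]
      _ < r := by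
          rw [abs_of_pos (by positivity)]
          have := min_le_right ε (r - dist z y); linarith
  · rw [mem_ball]
    calc dist (z - ↑(min ε (r - dist z y) / 2) * Complex.I) y
        ≤ dist (z - ↑(min ε (r - dist z y) / 2) * Complex.I) z + dist z y := dist_triangle _ _ _
      _ = |min ε (r - dist z y) / 2| + dist z y := by
          rw [dist_eq_norm, sub_sub_cancel_left, norm_neg, norm_mul, Complex.norm_real, Complex.norm_I,
            mul_one, Real.norm_eq_abs]
      _ < r := by
          rw [abs_of_pos (by positivity)]
          have := min_le_right ε (r - dist z y); linarith

/-- For a frontier point `y` of the open set `D` with flat frontier in `B(y, r)`, at least one of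
the two half-balls lies in `D`. [folklore] -/
theorem upperHalfBall_subset_or_lowerHalfBall_subset (hD : IsOpen D) (hy : y ∈ frontier D) (hr : 0 < r)
    (hflat : ∀ z ∈ frontier D, dist z y < r → z.im = y.im) :
    upperHalfBall y r ⊆ D ∨ lowerHalfBall y r ⊆ D := by
  by_contra h
  rw [not_or] at h
  have hup : Disjoint (upperHalfBall y r) (closure D) :=
    (upperHalfBall_subset_or_disjoint hD hflat).resolve_left h.1
  have hlow : Disjoint (lowerHalfBall y r) (closure D) :=
    (lowerHalfBall_subset_or_disjoint hD hflat).resolve_left h.2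
  -- `D` meets the ball
  have hyc : y ∈ closure D := frontier_subset_closure hy
  obtain ⟨z, hzball, hzD⟩ : ∃ z ∈ ball y r, z ∈ D := by
    have := Metric.mem_closure_iff.1 hyc r hr
    obtain ⟨z, hzD, hz⟩ := this
    exact ⟨z, mem_ball.2 (by rw [dist_comm]; exact hz), hzD⟩
  rcases lt_trichotomy y.im z.im with hlt | heq | hgt
  · exact hup.ne_of_mem ⟨hzball, hlt⟩ (subset_closure hzD) rfl
  · -- push `z` slightly up inside `D`
    obtain ⟨ε, hε, hεD⟩ := Metric.isOpen_iff.1 hD z hzD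
    obtain ⟨η, hη0, hηε, hηball, -⟩ := exists_add_I_mem_ball hzball hε
    have hz'D : z + η * Complex.I ∈ D := hεD (by
      rw [mem_ball, dist_eq_norm, add_sub_cancel_left, norm_mul, Complex.norm_real, Complex.norm_I,
        mul_one, Real.norm_eq_abs, abs_of_pos hη0]; exact hηε)
    refine hup.ne_of_mem ⟨hηball, ?_⟩ (subset_closure hz'D) rfl
    show y.im < (z + η * Complex.I).im
    simp [heq, hη0]
  · exact hlow.ne_of_mem ⟨hzball, hgt⟩ (subset_closure hzD) rfl

/-- If the upper half-ball lies in `D`, the diameter lies in `D̄`. [folklore] -/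
theorem mem_closure_of_im_eq_of_upper (hup : upperHalfBall y r ⊆ D) {z : ℂ} (hz : z ∈ ball y r)
    (hzim : z.im = y.im) : z ∈ closure D := by
  rw [Metric.mem_closure_iff]
  intro ε hε
  obtain ⟨η, hη0, hηε, hηball, -⟩ := exists_add_I_mem_ball hz hε
  refine ⟨z + η * Complex.I, hup ⟨hηball, ?_⟩, ?_⟩
  · show y.im < (z + η * Complex.I).im
    simp [hzim, hη0]
  · rw [dist_eq_norm, sub_add_cancel_left, norm_neg, norm_mul, Complex.norm_real, Complex.norm_I,
      mul_one, Real.norm_eq_abs, abs_of_pos hη0]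
    exact hηε

/-- If the lower half-ball lies in `D`, the diameter lies in `D̄`. [folklore] -/
theorem mem_closure_of_im_eq_of_lower (hlow : lowerHalfBall y r ⊆ D) {z : ℂ} (hz : z ∈ ball y r)
    (hzim : z.im = y.im) : z ∈ closure D := by
  rw [Metric.mem_closure_iff]
  intro ε hε
  obtain ⟨η, hη0, hηε, -, hηball⟩ := exists_add_I_mem_ball hz hε
  refine ⟨z - η * Complex.I, hlow ⟨hηball, ?_⟩, ?_⟩
  · show (z - η * Complex.I).im < y.im
    simp [hzim, hη0]
  · rw [dist_eq_norm, sub_sub_cancel, norm_mul, Complex.norm_real, Complex.norm_I, mul_one,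
      Real.norm_eq_abs, abs_of_pos hη0]
    exact hηε

/-- **One-sided structure, `D` above.** If the upper half-ball lies in `D` and the lower one misses
`D̄`, then inside the ball `z ∈ D̄ ↔ Im z ≥ Im y`. [folklore] -/
theorem mem_closure_iff_im_ge (hup : upperHalfBall y r ⊆ D) (hlow : Disjoint (lowerHalfBall y r) (closure D))
    {z : ℂ} (hz : z ∈ ball y r) : z ∈ closure D ↔ y.im ≤ z.im := by
  constructor
  · intro hzc
    by_contra hlt
    rw [not_le] at hlt
    exact hlow.ne_of_mem ⟨hz, hlt⟩ hzc rfl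
  · intro hle
    rcases hle.lt_or_eq with hlt | heq
    · exact subset_closure (hup ⟨hz, hlt⟩)
    · exact mem_closure_of_im_eq_of_upper hup hz heq.symm

/-- **One-sided structure, `D` below.** If the lower half-ball lies in `D` and the upper one misses
`D̄`, then inside the ball `z ∈ D̄ ↔ Im z ≤ Im y`. [folklore] -/
theorem mem_closure_iff_im_le (hlow : lowerHalfBall y r ⊆ D) (hup : Disjoint (upperHalfBall y r) (closure D))
    {z : ℂ} (hz : z ∈ ball y r) : z ∈ closure D ↔ z.im ≤ y.im := by
  constructor
  · intro hzc
    by_contra hlt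
    rw [not_le] at hlt
    exact hup.ne_of_mem ⟨hz, hlt⟩ hzc rfl
  · intro hle
    rcases hle.lt_or_eq with hlt | heq
    · exact subset_closure (hlow ⟨hz, hlt⟩)
    · exact mem_closure_of_im_eq_of_lower hlow hz heq

end Continuum

/-! ### The lattice near the flat boundary point -/

section Lattice

open WeakBeurling

variable {D : Set ℂ} {y : ℂ} {r δ : ℝ} {V : Finset (Site 2)}

/-- The mesh point of a lattice neighbour is at distance `δ`. [folklore] -/
theorem dist_meshPoint_add_cornerUnit (hδ : 0 < δ) (v : Site 2) (k : Fin 4) :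
    dist (meshPoint δ (v + cornerUnit k)) (meshPoint δ v) = δ := by
  rw [Complex.dist_eq, Complex.norm_eq_sqrt_sq_add_sq]
  simp only [Complex.sub_re, Complex.sub_im, meshPoint_re, meshPoint_im, Pi.add_apply, Int.cast_add]
  fin_cases k <;> simp [cornerUnit] <;> (ring_nf; exact Real.sqrt_sq hδ.le)

/-- Mesh points of the window are close to the mesh point of its centre:
`dist ≤ δ (|z₀ - b₀| + |z₁ - b₁|)`. [folklore] -/
theorem dist_meshPoint_le (hδ : 0 ≤ δ) (z b : Site 2) :
    dist (meshPoint δ z) (meshPoint δ b) ≤ δ * (|((z 0 - b 0 : ℤ) : ℝ)| + |((z 1 - b 1 : ℤ) : ℝ)|) := by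
  rw [Complex.dist_eq]
  have hre : (meshPoint δ z - meshPoint δ b).re = δ * ((z 0 - b 0 : ℤ) : ℝ) := by
    simp only [Complex.sub_re, meshPoint_re]; push_cast; ring
  have him : (meshPoint δ z - meshPoint δ b).im = δ * ((z 1 - b 1 : ℤ) : ℝ) := by
    simp only [Complex.sub_im, meshPoint_im]; push_cast; ring
  calc ‖meshPoint δ z - meshPoint δ b‖
      ≤ |(meshPoint δ z - meshPoint δ b).re| + |(meshPoint δ z - meshPoint δ b).im| :=
        Complex.norm_le_abs_re_add_abs_im _
    _ = δ * (|((z 0 - b 0 : ℤ) : ℝ)| + |((z 1 - b 1 : ℤ) : ℝ)|) := by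
        rw [hre, him, abs_mul, abs_mul, abs_of_nonneg hδ]; ring

/-- **Two-sidedness forces no outside neighbour.** If both half-balls lie in `D` and
`V = {v : meshPoint δ v ∈ D̄}`, then a lattice point whose mesh point lies `δ`-inside the ball has
all four lattice neighbours in `V`. [folklore] -/
theorem card_filter_not_mem_eq_zero_of_twoSided (hδ : 0 < δ)
    (hV : ∀ v : Site 2, v ∈ V ↔ meshPoint δ v ∈ closure D)
    (hup : upperHalfBall y r ⊆ D) (hlow : lowerHalfBall y r ⊆ D)
    {v : Site 2} (hv : dist (meshPoint δ v) y + δ < r) :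
    (((zdGraph 2).neighborFinset v).filter (fun u => u ∉ V)).card = 0 := by
  rw [Finset.card_eq_zero, Finset.filter_eq_empty_iff]
  intro u hu
  rw [SimpleGraph.mem_neighborFinset] at hu
  obtain ⟨k, rfl⟩ := exists_eq_add_cornerUnit_of_adj hu
  rw [not_not, hV]
  have hball : meshPoint δ (v + cornerUnit k) ∈ ball y r := by
    rw [mem_ball]
    calc dist (meshPoint δ (v + cornerUnit k)) y
        ≤ dist (meshPoint δ (v + cornerUnit k)) (meshPoint δ v) + dist (meshPoint δ v) y := dist_triangle _ _ _
      _ = δ + dist (meshPoint δ v) y := by rw [dist_meshPoint_add_cornerUnit hδ]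
      _ < r := by linarith
  rcases lt_trichotomy y.im (meshPoint δ (v + cornerUnit k)).im with hlt | heq | hgt
  · exact subset_closure (hup ⟨hball, hlt⟩)
  · exact mem_closure_of_im_eq_of_upper hup hball heq.symm
  · exact subset_closure (hlow ⟨hball, hgt⟩)

/-- **The hypothesis "exactly one neighbour outside `V`" forces one-sidedness** of `D` at the flat
boundary point: the two half-balls cannot both lie in `D`. [folklore] -/
theorem not_twoSided_of_card_eq_one (hδ : 0 < δ)
    (hV : ∀ v : Site 2, v ∈ V ↔ meshPoint δ v ∈ closure D)
    {b : Site 2} (hb : (((zdGraph 2).neighborFinset b).filter (fun u => u ∉ V)).card = 1)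
    (hbdist : dist (meshPoint δ b) y + δ < r) :
    ¬ (upperHalfBall y r ⊆ D ∧ lowerHalfBall y r ⊆ D) := by
  rintro ⟨hup, hlow⟩
  have := card_filter_not_mem_eq_zero_of_twoSided hδ hV hup hlow hbdist
  omega

/-- **The lattice window at a flat boundary point, `D` above.** If inside `B(y, r)` membership in
`D̄` is `Im z ≥ Im y`, `V = {v : meshPoint δ v ∈ D̄}`, and `b ∈ V` has exactly one lattice
neighbour outside `V` with `dist(meshPoint δ b, y) + 2δ(W + 1) < r`, then `b` lies on the lowest
lattice row of `D̄` near `y` and, for all `z` with `|z₀ - b₀| ≤ W`, `|z₁ - b₁| ≤ W`: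
`z ∈ V ↔ z₁ ≥ b₁`. [folklore] -/
theorem window_of_oneSided_ge (hδ : 0 < δ)
    (hV : ∀ v : Site 2, v ∈ V ↔ meshPoint δ v ∈ closure D)
    (hstruct : ∀ z ∈ ball y r, z ∈ closure D ↔ y.im ≤ z.im)
    {b : Site 2} (hbV : b ∈ V) (hb : (((zdGraph 2).neighborFinset b).filter (fun u => u ∉ V)).card = 1)
    {W : ℕ} (hbdist : dist (meshPoint δ b) y + 2 * δ * (W + 1) < r) :
    ∀ z : Site 2, |z 0 - b 0| ≤ W → |z 1 - b 1| ≤ W → (z ∈ V ↔ b 1 ≤ z 1) := by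
  -- membership near `b` is decided by the row
  have hrow : ∀ z : Site 2, dist (meshPoint δ z) (meshPoint δ b) + dist (meshPoint δ b) y < r →
      (z ∈ V ↔ y.im ≤ δ * z 1) := by
    intro z hz
    rw [hV, hstruct (meshPoint δ z) (mem_ball.2 (lt_of_le_of_lt (dist_triangle _ (meshPoint δ b) _) hz)),
      meshPoint_im]
  -- `b` is on the lowest row: `δ (b₁ - 1) < Im y ≤ δ b₁`
  have hb1 : y.im ≤ δ * b 1 := by
    have := (hrow b (by rw [dist_self, zero_add]; nlinarith [hδ, dist_nonneg (x := meshPoint δ b) (y := y)])).1 hbV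
    exact this
  have hb1' : δ * ((b 1 : ℝ) - 1) < y.im := by
    by_contra hge
    rw [not_lt] at hge
    -- then all four neighbours are in `V`
    have hall : ∀ k : Fin 4, b + cornerUnit k ∈ V := by
      intro k
      have hd : dist (meshPoint δ (b + cornerUnit k)) (meshPoint δ b) + dist (meshPoint δ b) y < r := by
        rw [dist_meshPoint_add_cornerUnit hδ]
        nlinarith [hδ, hbdist, (W.cast_nonneg : (0 : ℝ) ≤ W)]
      rw [hrow _ hd]
      have hc : (-1 : ℤ) ≤ cornerUnit k 1 := by fin_cases k <;> simp [cornerUnit]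
      have hc' : (b 1 : ℝ) - 1 ≤ ((b + cornerUnit k) 1 : ℝ) := by
        have := (Int.cast_le (R := ℝ)).2 hc
        simp only [Pi.add_apply, Int.cast_add]
        push_cast at this
        linarith
      exact hge.trans (mul_le_mul_of_nonneg_left hc' hδ.le)
    have h0 : (((zdGraph 2).neighborFinset b).filter (fun u => u ∉ V)).card = 0 := by
      rw [Finset.card_eq_zero, Finset.filter_eq_empty_iff]
      intro u hu
      rw [SimpleGraph.mem_neighborFinset] at hu
      obtain ⟨k, rfl⟩ := exists_eq_add_cornerUnit_of_adj hu
      rw [not_not]; exact hall k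
    omega
  intro z hz0 hz1
  have hzdist : dist (meshPoint δ z) (meshPoint δ b) + dist (meshPoint δ b) y < r := by
    have h1 := dist_meshPoint_le hδ.le z b
    have h0' : |((z 0 - b 0 : ℤ) : ℝ)| ≤ W := by
      rw [← Int.cast_abs]; exact_mod_cast hz0
    have h1' : |((z 1 - b 1 : ℤ) : ℝ)| ≤ W := by
      rw [← Int.cast_abs]; exact_mod_cast hz1
    nlinarith [hδ, hbdist]
  rw [hrow z hzdist]
  constructor
  · intro h
    by_contra hlt
    rw [not_le] at hlt
    have : (z 1 : ℝ) ≤ (b 1 : ℝ) - 1 := by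
      have : z 1 ≤ b 1 - 1 := by omega
      exact_mod_cast this
    nlinarith [hδ]
  · intro h
    have : (b 1 : ℝ) ≤ z 1 := by exact_mod_cast h
    nlinarith [hδ]

/-- **The lattice window at a flat boundary point, `D` below** (mirror of `window_of_oneSided_ge`):
if inside `B(y, r)` membership in `D̄` is `Im z ≤ Im y`, then a point `b ∈ V` with exactly one
lattice neighbour outside `V` and `dist(meshPoint δ b, y) + 2δ(W + 1) < r` lies on the highest
lattice row of `D̄` near `y` and `z ∈ V ↔ z₁ ≤ b₁` throughout the window. [folklore] -/
theorem window_of_oneSided_le (hδ : 0 < δ)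
    (hV : ∀ v : Site 2, v ∈ V ↔ meshPoint δ v ∈ closure D)
    (hstruct : ∀ z ∈ ball y r, z ∈ closure D ↔ z.im ≤ y.im)
    {b : Site 2} (hbV : b ∈ V) (hb : (((zdGraph 2).neighborFinset b).filter (fun u => u ∉ V)).card = 1)
    {W : ℕ} (hbdist : dist (meshPoint δ b) y + 2 * δ * (W + 1) < r) :
    ∀ z : Site 2, |z 0 - b 0| ≤ W → |z 1 - b 1| ≤ W → (z ∈ V ↔ z 1 ≤ b 1) := by
  have hrow : ∀ z : Site 2, dist (meshPoint δ z) (meshPoint δ b) + dist (meshPoint δ b) y < r →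
      (z ∈ V ↔ δ * z 1 ≤ y.im) := by
    intro z hz
    rw [hV, hstruct (meshPoint δ z) (mem_ball.2 (lt_of_le_of_lt (dist_triangle _ (meshPoint δ b) _) hz)),
      meshPoint_im]
  have hb1 : δ * b 1 ≤ y.im :=
    (hrow b (by rw [dist_self, zero_add]; nlinarith [hδ, dist_nonneg (x := meshPoint δ b) (y := y)])).1 hbV
  have hb1' : y.im < δ * ((b 1 : ℝ) + 1) := by
    by_contra hge
    rw [not_lt] at hge
    have hall : ∀ k : Fin 4, b + cornerUnit k ∈ V := by
      intro k
      have hd : dist (meshPoint δ (b + cornerUnit k)) (meshPoint δ b) + dist (meshPoint δ b) y < r := by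
        rw [dist_meshPoint_add_cornerUnit hδ]
        nlinarith [hδ, hbdist, (W.cast_nonneg : (0 : ℝ) ≤ W)]
      rw [hrow _ hd]
      have hc : cornerUnit k 1 ≤ (1 : ℤ) := by fin_cases k <;> simp [cornerUnit]
      have hc' : ((b + cornerUnit k) 1 : ℝ) ≤ (b 1 : ℝ) + 1 := by
        have := (Int.cast_le (R := ℝ)).2 hc
        simp only [Pi.add_apply, Int.cast_add]
        push_cast at this
        linarith
      exact (mul_le_mul_of_nonneg_left hc' hδ.le).trans hge
    have h0 : (((zdGraph 2).neighborFinset b).filter (fun u => u ∉ V)).card = 0 := by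
      rw [Finset.card_eq_zero, Finset.filter_eq_empty_iff]
      intro u hu
      rw [SimpleGraph.mem_neighborFinset] at hu
      obtain ⟨k, rfl⟩ := exists_eq_add_cornerUnit_of_adj hu
      rw [not_not]; exact hall k
    omega
  intro z hz0 hz1
  have hzdist : dist (meshPoint δ z) (meshPoint δ b) + dist (meshPoint δ b) y < r := by
    have h1 := dist_meshPoint_le hδ.le z b
    have h0' : |((z 0 - b 0 : ℤ) : ℝ)| ≤ W := by
      rw [← Int.cast_abs]; exact_mod_cast hz0
    have h1' : |((z 1 - b 1 : ℤ) : ℝ)| ≤ W := by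
      rw [← Int.cast_abs]; exact_mod_cast hz1
    nlinarith [hδ, hbdist]
  rw [hrow z hzdist]
  constructor
  · intro h
    by_contra hlt
    rw [not_le] at hlt
    have : (b 1 : ℝ) + 1 ≤ (z 1 : ℝ) := by
      have : b 1 + 1 ≤ z 1 := by omega
      exact_mod_cast this
    nlinarith [hδ]
  · intro h
    have : (z 1 : ℝ) ≤ b 1 := by exact_mod_cast h
    nlinarith [hδ]

end Lattice

/-! ### The vertical cases (frontier on a vertical line; `D` to the right or to the left) -/

section ContinuumV

variable {D : Set ℂ} {y : ℂ} {r : ℝ}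

/-- The open right half-ball at `y`. [folklore] -/
def rightHalfBall (y : ℂ) (r : ℝ) : Set ℂ := ball y r ∩ {z : ℂ | y.re < z.re}

/-- The open left half-ball at `y`. [folklore] -/
def leftHalfBall (y : ℂ) (r : ℝ) : Set ℂ := ball y r ∩ {z : ℂ | z.re < y.re}

/-- The right half-ball is convex. [folklore] -/
theorem convex_rightHalfBall (y : ℂ) (r : ℝ) : Convex ℝ (rightHalfBall y r) :=
  (convex_ball y r).inter (convex_halfSpace_re_gt y.re)

/-- The left half-ball is convex. [folklore] -/
theorem convex_leftHalfBall (y : ℂ) (r : ℝ) : Convex ℝ (leftHalfBall y r) :=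
  (convex_ball y r).inter (convex_halfSpace_re_lt y.re)

/-- A preconnected set inside the ball that misses the vertical line through `y` lies in `D` or
misses `D̄`, if the frontier of the open set `D` meets the ball only on that line. [folklore] -/
theorem subset_or_disjoint_of_flatV (hD : IsOpen D)
    (hflat : ∀ z ∈ frontier D, dist z y < r → z.re = y.re) {U : Set ℂ} (hU : IsPreconnected U)
    (hUball : U ⊆ ball y r) (hUline : ∀ z ∈ U, z.re ≠ y.re) :
    U ⊆ D ∨ Disjoint U (closure D) := by
  have hsub : U ⊆ D ∪ (closure D)ᶜ := by
    intro z hz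
    by_cases hzc : z ∈ closure D
    · left
      by_contra hzD
      have hzf : z ∈ frontier D := by rw [hD.frontier_eq]; exact ⟨hzc, hzD⟩
      exact hUline z hz (hflat z hzf (mem_ball.1 (hUball hz)))
    · exact Or.inr hzc
  rcases hU.subset_or_subset hD isClosed_closure.isOpen_compl
    (disjoint_compl_right.mono_left subset_closure) hsub with h | h
  · exact Or.inl h
  · exact Or.inr (Set.subset_compl_iff_disjoint_right.1 h)

/-- The right half-ball lies in `D` or misses `D̄`. [folklore] -/
theorem rightHalfBall_subset_or_disjoint (hD : IsOpen D)
    (hflat : ∀ z ∈ frontier D, dist z y < r → z.re = y.re) :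
    rightHalfBall y r ⊆ D ∨ Disjoint (rightHalfBall y r) (closure D) :=
  subset_or_disjoint_of_flatV hD hflat (convex_rightHalfBall y r).isPreconnected inter_subset_left
    fun _ hz => ne_of_gt hz.2

/-- The left half-ball lies in `D` or misses `D̄`. [folklore] -/
theorem leftHalfBall_subset_or_disjoint (hD : IsOpen D)
    (hflat : ∀ z ∈ frontier D, dist z y < r → z.re = y.re) :
    leftHalfBall y r ⊆ D ∨ Disjoint (leftHalfBall y r) (closure D) :=
  subset_or_disjoint_of_flatV hD hflat (convex_leftHalfBall y r).isPreconnected inter_subset_left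
    fun _ hz => ne_of_lt hz.2

/-- Shifting a point of the ball slightly to the right or left keeps it in the ball. [folklore] -/
theorem exists_add_one_mem_ball {z : ℂ} (hz : z ∈ ball y r) {ε : ℝ} (hε : 0 < ε) :
    ∃ η : ℝ, 0 < η ∧ η < ε ∧ z + (η : ℂ) ∈ ball y r ∧ z - (η : ℂ) ∈ ball y r := by
  have hslack : 0 < r - dist z y := by linarith [mem_ball.1 hz]
  refine ⟨min ε (r - dist z y) / 2, by positivity, by
    have := min_le_left ε (r - dist z y); linarith, ?_, ?_⟩
  · rw [mem_ball]
    calc dist (z + ((min ε (r - dist z y) / 2 : ℝ) : ℂ)) y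
        ≤ dist (z + ((min ε (r - dist z y) / 2 : ℝ) : ℂ)) z + dist z y := dist_triangle _ _ _
      _ = |min ε (r - dist z y) / 2| + dist z y := by
          rw [dist_eq_norm, add_sub_cancel_left, Complex.norm_real,
            Real.norm_eq_abs]
      _ < r := by
          rw [abs_of_pos (by positivity)]
          have := min_le_right ε (r - dist z y); linarith
  · rw [mem_ball]
    calc dist (z - ((min ε (r - dist z y) / 2 : ℝ) : ℂ)) y
        ≤ dist (z - ((min ε (r - dist z y) / 2 : ℝ) : ℂ)) z + dist z y := dist_triangle _ _ _
      _ = |min ε (r - dist z y) / 2| + dist z y := by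
          rw [dist_eq_norm, sub_sub_cancel_left, norm_neg, Complex.norm_real,
            Real.norm_eq_abs]
      _ < r := by
          rw [abs_of_pos (by positivity)]
          have := min_le_right ε (r - dist z y); linarith

/-- For a frontier point `y` of the open set `D` with flat frontier in `B(y, r)`, at least one of
the two half-balls lies in `D`. [folklore] -/
theorem rightHalfBall_subset_or_leftHalfBall_subset (hD : IsOpen D) (hy : y ∈ frontier D) (hr : 0 < r)
    (hflat : ∀ z ∈ frontier D, dist z y < r → z.re = y.re) :
    rightHalfBall y r ⊆ D ∨ leftHalfBall y r ⊆ D := by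
  by_contra h
  rw [not_or] at h
  have hup : Disjoint (rightHalfBall y r) (closure D) :=
    (rightHalfBall_subset_or_disjoint hD hflat).resolve_left h.1
  have hlow : Disjoint (leftHalfBall y r) (closure D) :=
    (leftHalfBall_subset_or_disjoint hD hflat).resolve_left h.2
  -- `D` meets the ball
  have hyc : y ∈ closure D := frontier_subset_closure hy
  obtain ⟨z, hzball, hzD⟩ : ∃ z ∈ ball y r, z ∈ D := by
    have := Metric.mem_closure_iff.1 hyc r hr
    obtain ⟨z, hzD, hz⟩ := this
    exact ⟨z, mem_ball.2 (by rw [dist_comm]; exact hz), hzD⟩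
  rcases lt_trichotomy y.re z.re with hlt | heq | hgt
  · exact hup.ne_of_mem ⟨hzball, hlt⟩ (subset_closure hzD) rfl
  · -- push `z` slightly up inside `D`
    obtain ⟨ε, hε, hεD⟩ := Metric.isOpen_iff.1 hD z hzD
    obtain ⟨η, hη0, hηε, hηball, -⟩ := exists_add_one_mem_ball hzball hε
    have hz'D : z + (η : ℂ) ∈ D := hεD (by
      rw [mem_ball, dist_eq_norm, add_sub_cancel_left, Complex.norm_real,
        Real.norm_eq_abs, abs_of_pos hη0]; exact hηε)
    refine hup.ne_of_mem ⟨hηball, ?_⟩ (subset_closure hz'D) rfl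
    show y.re < (z + (η : ℂ)).re
    simp [heq, hη0]
  · exact hlow.ne_of_mem ⟨hzball, hgt⟩ (subset_closure hzD) rfl

/-- If the right half-ball lies in `D`, the vertical diameter lies in `D̄`. [folklore] -/
theorem mem_closure_of_re_eq_of_right (hup : rightHalfBall y r ⊆ D) {z : ℂ} (hz : z ∈ ball y r)
    (hzre : z.re = y.re) : z ∈ closure D := by
  rw [Metric.mem_closure_iff]
  intro ε hε
  obtain ⟨η, hη0, hηε, hηball, -⟩ := exists_add_one_mem_ball hz hε
  refine ⟨z + (η : ℂ), hup ⟨hηball, ?_⟩, ?_⟩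
  · show y.re < (z + (η : ℂ)).re
    simp [hzre, hη0]
  · rw [dist_eq_norm, sub_add_cancel_left, norm_neg, Complex.norm_real,
      Real.norm_eq_abs, abs_of_pos hη0]
    exact hηε

/-- If the left half-ball lies in `D`, the vertical diameter lies in `D̄`. [folklore] -/
theorem mem_closure_of_re_eq_of_left (hlow : leftHalfBall y r ⊆ D) {z : ℂ} (hz : z ∈ ball y r)
    (hzre : z.re = y.re) : z ∈ closure D := by
  rw [Metric.mem_closure_iff]
  intro ε hε
  obtain ⟨η, hη0, hηε, -, hηball⟩ := exists_add_one_mem_ball hz hε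
  refine ⟨z - (η : ℂ), hlow ⟨hηball, ?_⟩, ?_⟩
  · show (z - (η : ℂ)).re < y.re
    simp [hzre, hη0]
  · rw [dist_eq_norm, sub_sub_cancel, Complex.norm_real,
      Real.norm_eq_abs, abs_of_pos hη0]
    exact hηε

/-- **One-sided structure, `D` to the right.** If the right half-ball lies in `D` and the lower one misses
`D̄`, then inside the ball `z ∈ D̄ ↔ Re z ≥ Re y`. [folklore] -/
theorem mem_closure_iff_re_ge (hup : rightHalfBall y r ⊆ D) (hlow : Disjoint (leftHalfBall y r) (closure D))
    {z : ℂ} (hz : z ∈ ball y r) : z ∈ closure D ↔ y.re ≤ z.re := by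
  constructor
  · intro hzc
    by_contra hlt
    rw [not_le] at hlt
    exact hlow.ne_of_mem ⟨hz, hlt⟩ hzc rfl
  · intro hle
    rcases hle.lt_or_eq with hlt | heq
    · exact subset_closure (hup ⟨hz, hlt⟩)
    · exact mem_closure_of_re_eq_of_right hup hz heq.symm

/-- **One-sided structure, `D` to the left.** If the left half-ball lies in `D` and the upper one misses
`D̄`, then inside the ball `z ∈ D̄ ↔ Re z ≤ Re y`. [folklore] -/
theorem mem_closure_iff_re_le (hlow : leftHalfBall y r ⊆ D) (hup : Disjoint (rightHalfBall y r) (closure D))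
    {z : ℂ} (hz : z ∈ ball y r) : z ∈ closure D ↔ z.re ≤ y.re := by
  constructor
  · intro hzc
    by_contra hlt
    rw [not_le] at hlt
    exact hup.ne_of_mem ⟨hz, hlt⟩ hzc rfl
  · intro hle
    rcases hle.lt_or_eq with hlt | heq
    · exact subset_closure (hlow ⟨hz, hlt⟩)
    · exact mem_closure_of_re_eq_of_left hlow hz heq

end ContinuumV

section LatticeV

open WeakBeurling

variable {D : Set ℂ} {y : ℂ} {r δ : ℝ} {V : Finset (Site 2)}

/-- **Two-sidedness forces no outside neighbour.** If both half-balls lie in `D` and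
`V = {v : meshPoint δ v ∈ D̄}`, then a lattice point whose mesh point lies `δ`-inside the ball has
all four lattice neighbours in `V`. [folklore] -/
theorem card_filter_not_mem_eq_zero_of_twoSidedV (hδ : 0 < δ)
    (hV : ∀ v : Site 2, v ∈ V ↔ meshPoint δ v ∈ closure D)
    (hup : rightHalfBall y r ⊆ D) (hlow : leftHalfBall y r ⊆ D)
    {v : Site 2} (hv : dist (meshPoint δ v) y + δ < r) :
    (((zdGraph 2).neighborFinset v).filter (fun u => u ∉ V)).card = 0 := by
  rw [Finset.card_eq_zero, Finset.filter_eq_empty_iff]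
  intro u hu
  rw [SimpleGraph.mem_neighborFinset] at hu
  obtain ⟨k, rfl⟩ := exists_eq_add_cornerUnit_of_adj hu
  rw [not_not, hV]
  have hball : meshPoint δ (v + cornerUnit k) ∈ ball y r := by
    rw [mem_ball]
    calc dist (meshPoint δ (v + cornerUnit k)) y
        ≤ dist (meshPoint δ (v + cornerUnit k)) (meshPoint δ v) + dist (meshPoint δ v) y := dist_triangle _ _ _
      _ = δ + dist (meshPoint δ v) y := by rw [dist_meshPoint_add_cornerUnit hδ]
      _ < r := by linarith
  rcases lt_trichotomy y.re (meshPoint δ (v + cornerUnit k)).re with hlt | heq | hgt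
  · exact subset_closure (hup ⟨hball, hlt⟩)
  · exact mem_closure_of_re_eq_of_right hup hball heq.symm
  · exact subset_closure (hlow ⟨hball, hgt⟩)

/-- **The hypothesis "exactly one neighbour outside `V`" forces one-sidedness** of `D` at the flat
boundary point: the two half-balls cannot both lie in `D`. [folklore] -/
theorem not_twoSidedV_of_card_eq_one (hδ : 0 < δ)
    (hV : ∀ v : Site 2, v ∈ V ↔ meshPoint δ v ∈ closure D)
    {b : Site 2} (hb : (((zdGraph 2).neighborFinset b).filter (fun u => u ∉ V)).card = 1)
    (hbdist : dist (meshPoint δ b) y + δ < r) :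
    ¬ (rightHalfBall y r ⊆ D ∧ leftHalfBall y r ⊆ D) := by
  rintro ⟨hup, hlow⟩
  have := card_filter_not_mem_eq_zero_of_twoSidedV hδ hV hup hlow hbdist
  omega

/-- **The lattice window at a flat boundary point, `D` to the right.** If inside `B(y, r)` membership in
`D̄` is `Re z ≥ Re y`, `V = {v : meshPoint δ v ∈ D̄}`, and `b ∈ V` has exactly one lattice
neighbour outside `V` with `dist(meshPoint δ b, y) + 2δ(W + 1) < r`, then `b` lies on the leftmost
lattice column of `D̄` near `y` and, for all `z` with `|z₀ - b₀| ≤ W`, `|z₁ - b₁| ≤ W`: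
`z ∈ V ↔ z₀ ≥ b₀`. [folklore] -/
theorem windowV_of_oneSided_ge (hδ : 0 < δ)
    (hV : ∀ v : Site 2, v ∈ V ↔ meshPoint δ v ∈ closure D)
    (hstruct : ∀ z ∈ ball y r, z ∈ closure D ↔ y.re ≤ z.re)
    {b : Site 2} (hbV : b ∈ V) (hb : (((zdGraph 2).neighborFinset b).filter (fun u => u ∉ V)).card = 1)
    {W : ℕ} (hbdist : dist (meshPoint δ b) y + 2 * δ * (W + 1) < r) :
    ∀ z : Site 2, |z 0 - b 0| ≤ W → |z 1 - b 1| ≤ W → (z ∈ V ↔ b 0 ≤ z 0) := by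
  -- membership near `b` is decided by the row
  have hrow : ∀ z : Site 2, dist (meshPoint δ z) (meshPoint δ b) + dist (meshPoint δ b) y < r →
      (z ∈ V ↔ y.re ≤ δ * z 0) := by
    intro z hz
    rw [hV, hstruct (meshPoint δ z) (mem_ball.2 (lt_of_le_of_lt (dist_triangle _ (meshPoint δ b) _) hz)),
      meshPoint_re]
  -- `b` is on the leftmost column: `δ (b₀ - 1) < Re y ≤ δ b₀`
  have hb1 : y.re ≤ δ * b 0 := by
    have := (hrow b (by rw [dist_self, zero_add]; nlinarith [hδ, dist_nonneg (x := meshPoint δ b) (y := y)])).1 hbV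
    exact this
  have hb1' : δ * ((b 0 : ℝ) - 1) < y.re := by
    by_contra hge
    rw [not_lt] at hge
    -- then all four neighbours are in `V`
    have hall : ∀ k : Fin 4, b + cornerUnit k ∈ V := by
      intro k
      have hd : dist (meshPoint δ (b + cornerUnit k)) (meshPoint δ b) + dist (meshPoint δ b) y < r := by
        rw [dist_meshPoint_add_cornerUnit hδ]
        nlinarith [hδ, hbdist, (W.cast_nonneg : (0 : ℝ) ≤ W)]
      rw [hrow _ hd]
      have hc : (-1 : ℤ) ≤ cornerUnit k 0 := by fin_cases k <;> simp [cornerUnit]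
      have hc' : (b 0 : ℝ) - 1 ≤ ((b + cornerUnit k) 0 : ℝ) := by
        have := (Int.cast_le (R := ℝ)).2 hc
        simp only [Pi.add_apply, Int.cast_add]
        push_cast at this
        linarith
      exact hge.trans (mul_le_mul_of_nonneg_left hc' hδ.le)
    have h0 : (((zdGraph 2).neighborFinset b).filter (fun u => u ∉ V)).card = 0 := by
      rw [Finset.card_eq_zero, Finset.filter_eq_empty_iff]
      intro u hu
      rw [SimpleGraph.mem_neighborFinset] at hu
      obtain ⟨k, rfl⟩ := exists_eq_add_cornerUnit_of_adj hu
      rw [not_not]; exact hall k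
    omega
  intro z hz0 hz1
  have hzdist : dist (meshPoint δ z) (meshPoint δ b) + dist (meshPoint δ b) y < r := by
    have h1 := dist_meshPoint_le hδ.le z b
    have h0' : |((z 0 - b 0 : ℤ) : ℝ)| ≤ W := by
      rw [← Int.cast_abs]; exact_mod_cast hz0
    have h1' : |((z 1 - b 1 : ℤ) : ℝ)| ≤ W := by
      rw [← Int.cast_abs]; exact_mod_cast hz1
    nlinarith [hδ, hbdist]
  rw [hrow z hzdist]
  constructor
  · intro h
    by_contra hlt
    rw [not_le] at hlt
    have : (z 0 : ℝ) ≤ (b 0 : ℝ) - 1 := by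
      have : z 0 ≤ b 0 - 1 := by omega
      exact_mod_cast this
    nlinarith [hδ]
  · intro h
    have : (b 0 : ℝ) ≤ z 0 := by exact_mod_cast h
    nlinarith [hδ]

/-- **The lattice window at a flat boundary point, `D` to the left** (mirror of `windowV_of_oneSided_ge`):
if inside `B(y, r)` membership in `D̄` is `Re z ≤ Re y`, then a point `b ∈ V` with exactly one
lattice neighbour outside `V` and `dist(meshPoint δ b, y) + 2δ(W + 1) < r` lies on the rightmost
lattice column of `D̄` near `y` and `z ∈ V ↔ z₀ ≤ b₀` throughout the window. [folklore] -/
theorem windowV_of_oneSided_le (hδ : 0 < δ)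
    (hV : ∀ v : Site 2, v ∈ V ↔ meshPoint δ v ∈ closure D)
    (hstruct : ∀ z ∈ ball y r, z ∈ closure D ↔ z.re ≤ y.re)
    {b : Site 2} (hbV : b ∈ V) (hb : (((zdGraph 2).neighborFinset b).filter (fun u => u ∉ V)).card = 1)
    {W : ℕ} (hbdist : dist (meshPoint δ b) y + 2 * δ * (W + 1) < r) :
    ∀ z : Site 2, |z 0 - b 0| ≤ W → |z 1 - b 1| ≤ W → (z ∈ V ↔ z 0 ≤ b 0) := by
  have hrow : ∀ z : Site 2, dist (meshPoint δ z) (meshPoint δ b) + dist (meshPoint δ b) y < r →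
      (z ∈ V ↔ δ * z 0 ≤ y.re) := by
    intro z hz
    rw [hV, hstruct (meshPoint δ z) (mem_ball.2 (lt_of_le_of_lt (dist_triangle _ (meshPoint δ b) _) hz)),
      meshPoint_re]
  have hb1 : δ * b 0 ≤ y.re :=
    (hrow b (by rw [dist_self, zero_add]; nlinarith [hδ, dist_nonneg (x := meshPoint δ b) (y := y)])).1 hbV
  have hb1' : y.re < δ * ((b 0 : ℝ) + 1) := by
    by_contra hge
    rw [not_lt] at hge
    have hall : ∀ k : Fin 4, b + cornerUnit k ∈ V := by
      intro k
      have hd : dist (meshPoint δ (b + cornerUnit k)) (meshPoint δ b) + dist (meshPoint δ b) y < r := by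
        rw [dist_meshPoint_add_cornerUnit hδ]
        nlinarith [hδ, hbdist, (W.cast_nonneg : (0 : ℝ) ≤ W)]
      rw [hrow _ hd]
      have hc : cornerUnit k 0 ≤ (1 : ℤ) := by fin_cases k <;> simp [cornerUnit]
      have hc' : ((b + cornerUnit k) 0 : ℝ) ≤ (b 0 : ℝ) + 1 := by
        have := (Int.cast_le (R := ℝ)).2 hc
        simp only [Pi.add_apply, Int.cast_add]
        push_cast at this
        linarith
      exact (mul_le_mul_of_nonneg_left hc' hδ.le).trans hge
    have h0 : (((zdGraph 2).neighborFinset b).filter (fun u => u ∉ V)).card = 0 := by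
      rw [Finset.card_eq_zero, Finset.filter_eq_empty_iff]
      intro u hu
      rw [SimpleGraph.mem_neighborFinset] at hu
      obtain ⟨k, rfl⟩ := exists_eq_add_cornerUnit_of_adj hu
      rw [not_not]; exact hall k
    omega
  intro z hz0 hz1
  have hzdist : dist (meshPoint δ z) (meshPoint δ b) + dist (meshPoint δ b) y < r := by
    have h1 := dist_meshPoint_le hδ.le z b
    have h0' : |((z 0 - b 0 : ℤ) : ℝ)| ≤ W := by
      rw [← Int.cast_abs]; exact_mod_cast hz0
    have h1' : |((z 1 - b 1 : ℤ) : ℝ)| ≤ W := by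
      rw [← Int.cast_abs]; exact_mod_cast hz1
    nlinarith [hδ, hbdist]
  rw [hrow z hzdist]
  constructor
  · intro h
    by_contra hlt
    rw [not_le] at hlt
    have : (b 0 : ℝ) + 1 ≤ (z 0 : ℝ) := by
      have : b 0 + 1 ≤ z 0 := by omega
      exact_mod_cast this
    nlinarith [hδ]
  · intro h
    have : (z 0 : ℝ) ≤ b 0 := by exact_mod_cast h
    nlinarith [hδ]

end LatticeV

end Literature.Probability.LatticeModels
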